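import Mathlib.Data.Matrix.Mul
import Mathlib.Data.Matrix.Basis
import Mathlib.Data.Matrix.Basic
import Mathlib.LinearAlgebra.Matrix.DotProduct
import Mathlib.LinearAlgebra.Matrix.Determinant.Basic
import Mathlib.LinearAlgebra.Matrix.Transvection
import Mathlib.LinearAlgebra.FiniteDimensional.Basic
import Mathlib.Analysis.Complex.Polynomial.Basic
import Mathlib.Tactic.LinearCombination
import Mathlib.Tactic.FieldSimp
import Literature.NumberTheory.DiophantineGeometry.DetStabilizerFrobenius
import HarnessLib

/-!
# Frobenius' determinant-preserver theorem: proof (Marcus–Moyls 1959, Thm. 2, (ii) ⇒ (iii))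

This file discharges the named fact
`Literature.NumberTheory.DiophantineGeometry.frobenius_detPreserver_unimodular_sandwich` of
`DetStabilizerFrobenius.lean` (`frobenius_detPreserver_unimodular_sandwich_holds`, at the end):
a square matrix `M` over the matrix index type `MatIdx m` whose linear substitution fixes the
determinant form `det_m` acts on `M_m(ℂ)`, `X ↦ mat (Mᵀ · vec X)`, as `X ↦ P X Q` or
`X ↦ P Xᵀ Q` with `det P = det Q = 1`.

We follow the architecture of M. Marcus, B. N. Moyls, *Linear transformations on algebras of
matrices*, Canad. J. Math. **11** (1959) 61–66 [MarcusMoyls1959]: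

* §2, Theorem 1 (p. 64): the structure `T(A) = UAV` or `UA'V` of rank preservers — here
  `MarcusMoyls.exists_sandwich_or_transpose_sandwich`, proved for a *bijective* `T` such that `T`
  and `T⁻¹` map matrices of rank `≤ 1` to matrices of rank `≤ 1` (the form in which Lemmas 7–8
  deliver the hypothesis; cf. the remark p. 66 on Hua 1948 and Jacob 1955).  Instead of the
  paper's block matrices `T_{ij}` and "collinear" families (Lemmas 1–5) we use the equivalent
  language of the maximal spaces of rank-one matrices: an additively closed family of matrices of
  rank `≤ 1` lies in a *row space* `{u wᵀ : w}` or a *column space* `{z vᵀ : z}`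
  (`MarcusMoyls.rankOne_family_subset_row_or_col`, from the "pair lemma"
  `MarcusMoyls.exists_eq_smul_of_rankOne_add`, the Grassmann-product computation of Lemma 2);
  the images of the row spaces of `e i` are then all row spaces or all column spaces
  (`rows_uniform`, Lemmas 4–5), composing with the transpose reduces to the first case, the
  images of the column spaces are column spaces (`cols_of_rows`), `T(E i j) = c i j • u i (v j)ᵀ`
  (`exists_coeff`, Lemma 4 (5)) with a coefficient matrix of rank one (`coeff_minor`, Lemma 4 (6)),
  whence `U` and `V` (`exists_sandwich_of_rows`).
* §3, Lemma 7 (p. 64): a determinant preserver is injective — `MarcusMoyls.injective_of_det_eq`,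
  proof as printed with Mathlib's reduction `A = P D Q` to diagonal form by transvections
  (`Matrix.Pivot.exists_list_transvec_mul_diagonal_mul_list_transvec`) in place of `MAN = I_r ⊕ 0`.
* §3, Lemma 8 (p. 64–65): a determinant preserver preserves rank — here only rank `≤ 1` is needed
  (`MarcusMoyls.rankOne_map_of_det_eq`), through the criterion "`X` has rank `≤ 1` iff
  `det (Y + X) + det (Y - X) = 2 det Y` for all `Y`" (`det_add_add_det_sub_of_rankOne`,
  `exists_det_add_add_det_sub_ne`), an elementary substitute for the degree count of
  `det (x Y₁ + Y₃)` in the paper; it needs `2 ≠ 0`.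
* §3, Theorem 2 (p. 65): `det U₁ V₁ = det T(I) = 1`, and over `ℂ` an `n`-th root of `det U₁`
  normalises to `det U = det V = 1` (`MarcusMoyls.exists_unimodular_sandwich_of_det_eq`; the cases
  `n ≤ 1` are trivial and treated apart).
* The bridge to the statement: `eval x (M · f) = eval (Mᵀ x) f` and
  `eval y det_m = det (mat y)` (`MarcusMoyls.eval_linSubst`, `MarcusMoyls.eval_detFormLex`).

Design (D-0026): no definition and no named fact is introduced; "`X` has rank `≤ 1`" is written
`∃ u w, X = vecMulVec u w` (`vecMulVec u w = u wᵀ`), "`v ∥ u`" is written `∃ c, v = c • u`, and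
"`T` maps the row space of `p` into the row space of `u`" is written
`∀ w, ∃ w', T (vecMulVec p w) = vecMulVec u w'`.  Sections 1–4 hold over an arbitrary field `K`
and a finite index type `n` (with `n ≥ 2` witnessed by `i₀ ≠ i₁` where needed); the helper
lemmas live in the sub-namespace `MarcusMoyls` (name of the source).  Mathlib has no
rank-one-preserver or determinant-preserver theorem (searched: `vecMulVec`, `preserv`,
`Frobenius` in `LinearAlgebra/Matrix`).
-/

namespace Literature.NumberTheory.DiophantineGeometry

namespace MarcusMoyls

open Matrix

variable {n : Type*} {K : Type*} [Field K]

/-! ### Proportional vectors -/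

/-- If `v = c • u` and `v ≠ 0` then `u` is a multiple of `v`. [folklore] -/
theorem exists_eq_smul_symm {u v : n → K} {c : K} (h : v = c • u) (hv : v ≠ 0) :
    ∃ d : K, u = d • v := by
  have hc : c ≠ 0 := by
    rintro rfl
    exact hv (by rw [h, zero_smul])
  exact ⟨c⁻¹, by rw [h, smul_smul, inv_mul_cancel₀ hc, one_smul]⟩

/-- If `v` is not a multiple of `u ≠ 0` then some `2 × 2` minor of the pair `(u, v)` is non-zero.
[folklore] -/
theorem exists_minor_ne_zero {u v : n → K} (hu : u ≠ 0) (h : ∀ c : K, v ≠ c • u) :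
    ∃ a b, u a * v b - u b * v a ≠ 0 := by
  by_contra! H
  obtain ⟨a, ha⟩ : ∃ a, u a ≠ 0 := by
    by_contra! h0
    exact hu (funext h0)
  refine h (v a / u a) (funext fun b => ?_)
  have hb := H a b
  rw [sub_eq_zero] at hb
  rw [Pi.smul_apply, smul_eq_mul]
  field_simp
  linear_combination hb

/-! ### Rank `≤ 1` matrices `vecMulVec u w = u wᵀ` -/

/-- Comparing two outer products with the same non-zero left factor: `u aᵀ = z bᵀ`, `u ≠ 0`
forces `a ∈ K b`. [folklore] -/
theorem exists_eq_smul_of_vecMulVec_eq_left {u a z b : n → K} (h : vecMulVec u a = vecMulVec z b)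
    (hu : u ≠ 0) : ∃ c : K, a = c • b := by
  obtain ⟨p, hp⟩ : ∃ p, u p ≠ 0 := by
    by_contra! h0
    exact hu (funext h0)
  refine ⟨z p / u p, funext fun j => ?_⟩
  have hj := congr_fun (congr_fun h p) j
  simp only [vecMulVec_apply] at hj
  rw [Pi.smul_apply, smul_eq_mul]
  field_simp
  linear_combination hj

/-- Comparing two outer products with the same non-zero right factor: `a uᵀ = b zᵀ`, `u ≠ 0`
forces `a ∈ K b`. [folklore] -/
theorem exists_eq_smul_of_vecMulVec_eq_right {u a z b : n → K}
    (h : vecMulVec a u = vecMulVec b z) (hu : u ≠ 0) : ∃ c : K, a = c • b := by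
  refine exists_eq_smul_of_vecMulVec_eq_left (u := u) (z := z) ?_ hu
  rw [← transpose_vecMulVec a u, h, transpose_vecMulVec]

/-- A matrix lying in the row space of `u ≠ 0` and in the column space of `v ≠ 0` is a multiple of
`u vᵀ`. [folklore] -/
theorem exists_eq_smul_vecMulVec {u a b v : n → K} (h : vecMulVec u a = vecMulVec b v)
    (hu : u ≠ 0) : ∃ c : K, vecMulVec u a = c • vecMulVec u v := by
  obtain ⟨c, rfl⟩ := exists_eq_smul_of_vecMulVec_eq_left h hu
  exact ⟨c, vecMulVec_smul c u v⟩

variable [Fintype n]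

/-- `(u wᵀ) x = (w ⬝ x) u`. [folklore] -/
theorem vecMulVec_mulVec_eq_smul (u w x : n → K) : vecMulVec u w *ᵥ x = (w ⬝ᵥ x) • u := by
  ext i
  simp [mulVec, dotProduct, vecMulVec_apply, Finset.mul_sum, mul_comm, mul_left_comm]

variable [DecidableEq n]

/-- **Separation of two non-proportional vectors** (dual basis of the plane they span): if `u ≠ 0`
and `v ∉ K u` there are `x, y` with `u ⬝ x = 1`, `v ⬝ x = 0`, `u ⬝ y = 0`, `v ⬝ y = 1`. [folklore] -/
theorem exists_dotProduct_separating {u v : n → K} (hu : u ≠ 0) (h : ∀ c : K, v ≠ c • u) :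
    ∃ x y : n → K, u ⬝ᵥ x = 1 ∧ v ⬝ᵥ x = 0 ∧ u ⬝ᵥ y = 0 ∧ v ⬝ᵥ y = 1 := by
  obtain ⟨a, b, hab⟩ := exists_minor_ne_zero hu h
  refine ⟨(u a * v b - u b * v a)⁻¹ • (v b • Pi.single a 1 - v a • Pi.single b 1),
    (u a * v b - u b * v a)⁻¹ • (u a • Pi.single b 1 - u b • Pi.single a 1), ?_, ?_, ?_, ?_⟩
  · simp only [dotProduct_smul, dotProduct_sub, dotProduct_single, mul_one, smul_eq_mul]
    field_simp
  · simp only [dotProduct_smul, dotProduct_sub, dotProduct_single, mul_one, smul_eq_mul]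
    ring
  · simp only [dotProduct_smul, dotProduct_sub, dotProduct_single, mul_one, smul_eq_mul]
    ring
  · simp only [dotProduct_smul, dotProduct_sub, dotProduct_single, mul_one, smul_eq_mul]
    field_simp

/-- **Pair lemma.** If `u₁ w₁ᵀ + u₂ w₂ᵀ` has rank `≤ 1`, `u₁ ≠ 0`, `w₁ ≠ 0` and `w₂ ∉ K w₁`, then
`u₂ ∈ K u₁` (evaluate on vectors separating `w₁` from `w₂`).  This is the computation behind
Marcus–Moyls' Lemma 2 (Grassmann products of collinear columns). [cite: MarcusMoyls1959, §2, Lemma 2] -/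
theorem exists_eq_smul_of_rankOne_add {u₁ w₁ u₂ w₂ : n → K} (hu₁ : u₁ ≠ 0) (hw₁ : w₁ ≠ 0)
    (hw : ∀ c : K, w₂ ≠ c • w₁)
    (h : ∃ u w : n → K, vecMulVec u₁ w₁ + vecMulVec u₂ w₂ = vecMulVec u w) :
    ∃ c : K, u₂ = c • u₁ := by
  obtain ⟨u, w, huw⟩ := h
  obtain ⟨x, y, h1x, h2x, h1y, h2y⟩ := exists_dotProduct_separating hw₁ hw
  have hx : u₁ = (w ⬝ᵥ x) • u := by
    have := congr_arg (fun Z => Z *ᵥ x) huw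
    simpa only [add_mulVec, vecMulVec_mulVec_eq_smul, h1x, h2x, one_smul, zero_smul,
      add_zero] using this
  have hy : u₂ = (w ⬝ᵥ y) • u := by
    have := congr_arg (fun Z => Z *ᵥ y) huw
    simpa only [add_mulVec, vecMulVec_mulVec_eq_smul, h1y, h2y, one_smul, zero_smul,
      zero_add] using this
  have hc : w ⬝ᵥ x ≠ 0 := by
    rintro h0
    rw [h0, zero_smul] at hx
    exact hu₁ hx
  refine ⟨(w ⬝ᵥ y) * (w ⬝ᵥ x)⁻¹, ?_⟩
  rw [hy, hx, smul_smul, mul_assoc, inv_mul_cancel₀ hc, mul_one]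

/-- **Pair lemma, transposed form.** If `u₁ w₁ᵀ + u₂ w₂ᵀ` has rank `≤ 1`, `u₁ ≠ 0`, `w₁ ≠ 0` and
`u₂ ∉ K u₁`, then `w₂ ∈ K w₁`. [cite: MarcusMoyls1959, §2, Lemma 2] -/
theorem exists_eq_smul_of_rankOne_add' {u₁ w₁ u₂ w₂ : n → K} (hu₁ : u₁ ≠ 0) (hw₁ : w₁ ≠ 0)
    (hu : ∀ c : K, u₂ ≠ c • u₁)
    (h : ∃ u w : n → K, vecMulVec u₁ w₁ + vecMulVec u₂ w₂ = vecMulVec u w) :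
    ∃ c : K, w₂ = c • w₁ := by
  refine exists_eq_smul_of_rankOne_add hw₁ hu₁ hu ?_
  obtain ⟨u, w, huw⟩ := h
  refine ⟨w, u, ?_⟩
  have := congr_arg transpose huw
  simpa only [transpose_add, transpose_vecMulVec] using this

/-! ### Additively closed families of rank `≤ 1` matrices -/

/-- **Spaces of rank-one matrices are row spaces or column spaces.**  Let `S` be a family of
`n × n` matrices of rank `≤ 1` closed under addition (e.g. a linear subspace, or the image of one
under an additive rank-one preserver).  Then either all members of `S` have the form `u wᵀ` for one
fixed `u ≠ 0`, or all have the form `z vᵀ` for one fixed `v ≠ 0`.  (The maximal linear spaces of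
matrices of rank `≤ 1` are exactly these; Marcus–Moyls phrase the same dichotomy through
"collinear" families, Lemmas 1–3.)  The index `i₀` only witnesses `n ≠ ∅`. [cite: MarcusMoyls1959, §2, Lemmas 1–3] -/
theorem rankOne_family_subset_row_or_col {S : Set (Matrix n n K)}
    (h1 : ∀ X ∈ S, ∃ u w : n → K, X = vecMulVec u w)
    (hadd : ∀ X ∈ S, ∀ Y ∈ S, X + Y ∈ S) (i₀ : n) :
    (∃ u : n → K, u ≠ 0 ∧ ∀ X ∈ S, ∃ w, X = vecMulVec u w) ∨
      (∃ v : n → K, v ≠ 0 ∧ ∀ X ∈ S, ∃ z, X = vecMulVec z v) := by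
  by_cases hA : ∀ X ∈ S, X = 0
  · refine Or.inl ⟨Pi.single i₀ 1, ?_, fun X hX => ⟨0, ?_⟩⟩
    · intro h0
      have h1 := congr_fun h0 i₀
      simp at h1
    · rw [hA X hX, vecMulVec_zero]
  push Not at hA
  obtain ⟨X₁, hX₁S, hX₁⟩ := hA
  obtain ⟨u₁, w₁, rfl⟩ := h1 X₁ hX₁S
  have hu₁ : u₁ ≠ 0 := fun h0 => hX₁ (by rw [h0, zero_vecMulVec])
  have hw₁ : w₁ ≠ 0 := fun h0 => hX₁ (by rw [h0, vecMulVec_zero])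
  by_cases hB : ∀ Y ∈ S, ∃ w, Y = vecMulVec u₁ w
  · exact Or.inl ⟨u₁, hu₁, hB⟩
  push Not at hB
  obtain ⟨Y, hYS, hY⟩ := hB
  obtain ⟨u₂, w₂, rfl⟩ := h1 Y hYS
  have hu : ∀ c : K, u₂ ≠ c • u₁ := by
    intro c hc
    refine hY (c • w₂) ?_
    rw [hc, smul_vecMulVec, vecMulVec_smul]
  -- the pair lemma: `w₂ ∥ w₁`
  obtain ⟨c₂, hc₂⟩ : ∃ c : K, w₂ = c • w₁ :=
    exists_eq_smul_of_rankOne_add' hu₁ hw₁ hu (h1 _ (hadd _ hX₁S _ hYS))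
  have hu₂ : u₂ ≠ 0 := by
    rintro rfl
    exact hu 0 (by rw [zero_smul])
  refine Or.inr ⟨w₁, hw₁, fun Z hZS => ?_⟩
  obtain ⟨u₃, w₃, rfl⟩ := h1 Z hZS
  by_cases hu₃ : u₃ = 0
  · exact ⟨0, by rw [hu₃, zero_vecMulVec, zero_vecMulVec]⟩
  by_cases hw₃ : ∃ c : K, w₃ = c • w₁
  · obtain ⟨c, rfl⟩ := hw₃
    exact ⟨c • u₃, by rw [smul_vecMulVec, vecMulVec_smul]⟩
  push Not at hw₃
  exfalso
  -- `w₃ ∦ w₁`, hence `w₃ ∦ w₂`, so `u₃ ∥ u₁` and `u₃ ∥ u₂`, forcing `u₂ ∥ u₁`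
  have hw₃' : ∀ c : K, w₃ ≠ c • w₂ := by
    intro c hc
    exact hw₃ (c * c₂) (by rw [hc, hc₂, smul_smul])
  obtain ⟨d₁, hd₁⟩ : ∃ c : K, u₃ = c • u₁ :=
    exists_eq_smul_of_rankOne_add hu₁ hw₁ hw₃ (h1 _ (hadd _ hX₁S _ hZS))
  have hw₂ : w₂ ≠ 0 := by
    rintro h0
    exact hY 0 (by rw [h0, vecMulVec_zero, vecMulVec_zero])
  obtain ⟨d₂, hd₂⟩ : ∃ c : K, u₃ = c • u₂ :=
    exists_eq_smul_of_rankOne_add hu₂ hw₂ hw₃' (h1 _ (hadd _ hYS _ hZS))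
  obtain ⟨d₃, hd₃⟩ := exists_eq_smul_symm hd₂ hu₃
  exact hu (d₃ * d₁) (by rw [hd₃, hd₁, smul_smul])


/-! ### Rank-one preservers: rows and columns go to row spaces or column spaces -/

section Preserver

variable {T S : Matrix n n K →ₗ[K] Matrix n n K}

omit [Fintype n] in
/-- `e i ≠ 0`. [folklore] -/
theorem single_one_ne_zero (i : n) : (Pi.single i 1 : n → K) ≠ 0 := by
  intro h
  have := congr_fun h i
  simp at this

omit [Fintype n] in
/-- `e k ∉ K e i` for `i ≠ k`. [folklore] -/
theorem single_ne_smul_single {i k : n} (hik : i ≠ k) (c : K) :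
    (Pi.single k 1 : n → K) ≠ c • Pi.single i 1 := by
  intro h
  have := congr_fun h k
  simp [hik.symm] at this

omit [Fintype n] in
/-- `e i wᵀ = e k w'ᵀ` with `i ≠ k` forces `w = 0`. [folklore] -/
theorem eq_zero_of_vecMulVec_single_eq {i k : n} (hik : i ≠ k) {w w' : n → K}
    (hE : vecMulVec (Pi.single i (1 : K)) w = vecMulVec (Pi.single k 1) w') : w = 0 := by
  funext b
  have := congr_fun (congr_fun hE i) b
  simpa [vecMulVec_apply, hik] using this

/-- The image of a row space `{p wᵀ : w}` under an additive map preserving rank `≤ 1` lies in a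
row space `{u w'ᵀ}` (`u ≠ 0`) or in a column space `{z vᵀ}` (`v ≠ 0`).
[cite: MarcusMoyls1959, §2, Lemmas 1–3] -/
theorem row_image_subset (hT : ∀ u w : n → K, ∃ u' w', T (vecMulVec u w) = vecMulVec u' w')
    (i₀ : n) (p : n → K) :
    (∃ u : n → K, u ≠ 0 ∧ ∀ w, ∃ w', T (vecMulVec p w) = vecMulVec u w') ∨
      (∃ v : n → K, v ≠ 0 ∧ ∀ w, ∃ z, T (vecMulVec p w) = vecMulVec z v) := by
  rcases rankOne_family_subset_row_or_col (S := {X | ∃ w, X = T (vecMulVec p w)})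
      (by rintro X ⟨w, rfl⟩; exact hT p w)
      (by rintro X ⟨w, rfl⟩ Y ⟨w', rfl⟩; exact ⟨w + w', by rw [vecMulVec_add, map_add]⟩) i₀ with
    ⟨u, hu, h⟩ | ⟨v, hv, h⟩
  · exact Or.inl ⟨u, hu, fun w => h _ ⟨w, rfl⟩⟩
  · exact Or.inr ⟨v, hv, fun w => h _ ⟨w, rfl⟩⟩

/-- The image of a column space `{z qᵀ : z}` under an additive map preserving rank `≤ 1` lies in a
row space or in a column space. [cite: MarcusMoyls1959, §2, Lemmas 1–3] -/
theorem col_image_subset (hT : ∀ u w : n → K, ∃ u' w', T (vecMulVec u w) = vecMulVec u' w')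
    (i₀ : n) (q : n → K) :
    (∃ u : n → K, u ≠ 0 ∧ ∀ z, ∃ w', T (vecMulVec z q) = vecMulVec u w') ∨
      (∃ v : n → K, v ≠ 0 ∧ ∀ z, ∃ z', T (vecMulVec z q) = vecMulVec z' v) := by
  rcases rankOne_family_subset_row_or_col (S := {X | ∃ z, X = T (vecMulVec z q)})
      (by rintro X ⟨z, rfl⟩; exact hT z q)
      (by rintro X ⟨z, rfl⟩ Y ⟨z', rfl⟩; exact ⟨z + z', by rw [add_vecMulVec, map_add]⟩) i₀ with
    ⟨u, hu, h⟩ | ⟨v, hv, h⟩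
  · exact Or.inl ⟨u, hu, fun z => h _ ⟨z, rfl⟩⟩
  · exact Or.inr ⟨v, hv, fun z => h _ ⟨z, rfl⟩⟩

/-- **Onto-ness of the image of a row space.**  If `T` (with inverse `S`, both preserving rank
`≤ 1`) maps the row space of `p ≠ 0` into the row space of `u`, then `S` maps the row space
of `u` into (hence, by injectivity, onto) the row space of `p` (`n ≥ 2`: `i₀ ≠ i₁`).
[cite: MarcusMoyls1959, §2] -/
theorem row_image_onto (hST : ∀ X, S (T X) = X)
    (hS : ∀ u w : n → K, ∃ u' w', S (vecMulVec u w) = vecMulVec u' w')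
    {i₀ i₁ : n} (h01 : i₀ ≠ i₁) {p u : n → K} (hp : p ≠ 0)
    (h : ∀ w, ∃ w', T (vecMulVec p w) = vecMulVec u w') :
    ∀ w', ∃ w, S (vecMulVec u w') = vecMulVec p w := by
  rcases row_image_subset hS i₀ u with ⟨u', -, h'⟩ | ⟨v', hv', h'⟩
  · obtain ⟨w₀, hw₀⟩ := h (Pi.single i₀ 1)
    obtain ⟨w₀', hw₀'⟩ := h' w₀
    have key : vecMulVec p (Pi.single i₀ 1) = vecMulVec u' w₀' := by
      rw [← hST (vecMulVec p _), hw₀, hw₀']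
    obtain ⟨c, hc⟩ := exists_eq_smul_of_vecMulVec_eq_right key (single_one_ne_zero i₀)
    obtain ⟨d, hd⟩ := exists_eq_smul_symm hc hp
    intro w'
    obtain ⟨w'', hw''⟩ := h' w'
    exact ⟨d • w'', by rw [hw'', hd, smul_vecMulVec, vecMulVec_smul]⟩
  · exfalso
    have key : ∀ w, ∃ c : K, w = c • v' := by
      intro w
      obtain ⟨w₀, hw₀⟩ := h w
      obtain ⟨z, hz⟩ := h' w₀
      have hpw : vecMulVec p w = vecMulVec z v' := by rw [← hST (vecMulVec p _), hw₀, hz]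
      exact exists_eq_smul_of_vecMulVec_eq_left hpw hp
    obtain ⟨c₀, hc₀⟩ := key (Pi.single i₀ 1)
    obtain ⟨c₁, hc₁⟩ := key (Pi.single i₁ 1)
    obtain ⟨d, hd⟩ := exists_eq_smul_symm hc₀ (single_one_ne_zero i₀)
    exact single_ne_smul_single h01 (c₁ * d) (by rw [hc₁, hd, smul_smul])

/-- Onto-ness, mixed form: if `T` maps the row space of `p ≠ 0` into the column space of `v`,
then `S` maps the column space of `v` into the row space of `p` (apply `row_image_onto` to
`X ↦ (T X)ᵀ`). [cite: MarcusMoyls1959, §2] -/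
theorem row_image_onto' (hST : ∀ X, S (T X) = X)
    (hS : ∀ u w : n → K, ∃ u' w', S (vecMulVec u w) = vecMulVec u' w')
    {i₀ i₁ : n} (h01 : i₀ ≠ i₁) {p v : n → K} (hp : p ≠ 0)
    (h : ∀ w, ∃ z, T (vecMulVec p w) = vecMulVec z v) :
    ∀ z', ∃ w, S (vecMulVec z' v) = vecMulVec p w := by
  have hST' : ∀ X, (S ∘ₗ (transposeLinearEquiv n n K K).toLinearMap)
      (((transposeLinearEquiv n n K K).toLinearMap ∘ₗ T) X) = X := fun X => by simp [hST]
  have hS' : ∀ u w : n → K, ∃ u' w',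
      (S ∘ₗ (transposeLinearEquiv n n K K).toLinearMap) (vecMulVec u w) = vecMulVec u' w' := by
    intro u w
    obtain ⟨u', w', huw⟩ := hS w u
    exact ⟨u', w', by simp [huw]⟩
  have h' : ∀ w, ∃ w', ((transposeLinearEquiv n n K K).toLinearMap ∘ₗ T) (vecMulVec p w) =
      vecMulVec v w' := by
    intro w
    obtain ⟨z, hz⟩ := h w
    exact ⟨z, by simp [hz]⟩
  intro z'
  obtain ⟨w, hw⟩ := row_image_onto hST' hS' h01 hp h' z'
  exact ⟨w, by simpa using hw⟩

/-- Onto-ness for column spaces: if `T` maps the column space of `q ≠ 0` into the column space of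
`v`, then `S` maps the column space of `v` into the column space of `q` (apply
`row_image_onto` to `X ↦ (T Xᵀ)ᵀ`). [cite: MarcusMoyls1959, §2] -/
theorem col_image_onto (hST : ∀ X, S (T X) = X)
    (hS : ∀ u w : n → K, ∃ u' w', S (vecMulVec u w) = vecMulVec u' w')
    {i₀ i₁ : n} (h01 : i₀ ≠ i₁) {q v : n → K} (hq : q ≠ 0)
    (h : ∀ z, ∃ z', T (vecMulVec z q) = vecMulVec z' v) :
    ∀ z', ∃ z, S (vecMulVec z' v) = vecMulVec z q := by
  set τ := (transposeLinearEquiv n n K K).toLinearMap with hτ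
  have hST' : ∀ X, (τ ∘ₗ S ∘ₗ τ) ((τ ∘ₗ T ∘ₗ τ) X) = X := fun X => by simp [hτ, hST]
  have hS' : ∀ u w : n → K, ∃ u' w', (τ ∘ₗ S ∘ₗ τ) (vecMulVec u w) = vecMulVec u' w' := by
    intro u w
    obtain ⟨u', w', huw⟩ := hS w u
    exact ⟨w', u', by simp [hτ, huw]⟩
  have h' : ∀ w, ∃ w', (τ ∘ₗ T ∘ₗ τ) (vecMulVec q w) = vecMulVec v w' := by
    intro w
    obtain ⟨z', hz'⟩ := h w
    exact ⟨z', by simp [hτ, hz']⟩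
  intro z'
  obtain ⟨w, hw⟩ := row_image_onto hST' hS' h01 hq h' z'
  refine ⟨w, ?_⟩
  have := congr_arg transpose hw
  simpa [hτ] using this

/-- **Distinct rows have non-proportional images.**  If `T` maps the row spaces of `e i` and of
`e k` (`i ≠ k`) into the row spaces of `u` and `u'`, then `u' ∉ K u`.
[cite: MarcusMoyls1959, §2, Lemma 4] -/
theorem not_smul_of_rows (hST : ∀ X, S (T X) = X)
    (hS : ∀ u w : n → K, ∃ u' w', S (vecMulVec u w) = vecMulVec u' w')
    {i₀ i₁ : n} (h01 : i₀ ≠ i₁) {i k : n} (hik : i ≠ k) {u u' : n → K}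
    (hi : ∀ w, ∃ w', T (vecMulVec (Pi.single i 1) w) = vecMulVec u w')
    (hk : ∀ w, ∃ w', T (vecMulVec (Pi.single k 1) w) = vecMulVec u' w') :
    ∀ c : K, u' ≠ c • u := by
  intro c hc
  obtain ⟨w', hw'⟩ := hk (Pi.single i 1)
  obtain ⟨w, hw⟩ := row_image_onto hST hS h01 (single_one_ne_zero i) hi (c • w')
  have hE : vecMulVec (Pi.single k (1 : K)) (Pi.single i 1) = vecMulVec (Pi.single i 1) w := by
    rw [← hST (vecMulVec _ _), hw', hc, smul_vecMulVec, ← vecMulVec_smul, hw]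
  have h0 := eq_zero_of_vecMulVec_single_eq (Ne.symm hik) hE
  exact single_one_ne_zero i h0

/-- **Distinct columns have non-proportional images** (column version of `not_smul_of_rows`).
[cite: MarcusMoyls1959, §2, Lemma 4] -/
theorem not_smul_of_cols (hST : ∀ X, S (T X) = X)
    (hS : ∀ u w : n → K, ∃ u' w', S (vecMulVec u w) = vecMulVec u' w')
    {i₀ i₁ : n} (h01 : i₀ ≠ i₁) {j l : n} (hjl : j ≠ l) {v v' : n → K}
    (hj : ∀ z, ∃ z', T (vecMulVec z (Pi.single j 1)) = vecMulVec z' v)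
    (hl : ∀ z, ∃ z', T (vecMulVec z (Pi.single l 1)) = vecMulVec z' v') :
    ∀ c : K, v' ≠ c • v := by
  intro c hc
  obtain ⟨z', hz'⟩ := hl (Pi.single j 1)
  obtain ⟨z, hz⟩ := col_image_onto hST hS h01 (single_one_ne_zero j) hj (c • z')
  have hE : vecMulVec (Pi.single j (1 : K)) (Pi.single l 1) = vecMulVec z (Pi.single j 1) := by
    rw [← hST (vecMulVec _ _), hz', hc, vecMulVec_smul, ← smul_vecMulVec, hz]
  have hE' : vecMulVec (Pi.single l (1 : K)) (Pi.single j 1) = vecMulVec (Pi.single j 1) z := by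
    rw [← transpose_vecMulVec, hE, transpose_vecMulVec]
  exact single_one_ne_zero j (eq_zero_of_vecMulVec_single_eq (Ne.symm hjl) hE')

/-- **No mixed rows.**  It is impossible that `T` maps the row space of `e i` into a row space and
the row space of `e k`, `k ≠ i`, into a column space (the two images would share the line
`K u vᵀ`, contradicting injectivity). [cite: MarcusMoyls1959, §2, Lemma 4] -/
theorem not_mixed_rows (hST : ∀ X, S (T X) = X) (hTS : ∀ X, T (S X) = X)
    (hS : ∀ u w : n → K, ∃ u' w', S (vecMulVec u w) = vecMulVec u' w')
    {i₀ i₁ : n} (h01 : i₀ ≠ i₁) {i k : n} (hik : i ≠ k) {u v : n → K} (hu : u ≠ 0) (hv : v ≠ 0)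
    (hi : ∀ w, ∃ w', T (vecMulVec (Pi.single i 1) w) = vecMulVec u w')
    (hk : ∀ w, ∃ z, T (vecMulVec (Pi.single k 1) w) = vecMulVec z v) : False := by
  obtain ⟨w, hw⟩ := row_image_onto hST hS h01 (single_one_ne_zero i) hi v
  obtain ⟨w', hw'⟩ := row_image_onto' hST hS h01 (single_one_ne_zero k) hk u
  have hw0 : w = 0 := eq_zero_of_vecMulVec_single_eq hik (hw.symm.trans hw')
  have h0 : vecMulVec u v = 0 := by rw [← hTS (vecMulVec u v), hw, hw0, vecMulVec_zero, map_zero]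
  rcases vecMulVec_eq_zero.mp h0 with h | h
  · exact hu h
  · exact hv h

/-- **All rows have the same type**: either every row space `{e i wᵀ}` is mapped into a row space,
or every one is mapped into a column space. [cite: MarcusMoyls1959, §2, Lemmas 4–5] -/
theorem rows_uniform (hST : ∀ X, S (T X) = X) (hTS : ∀ X, T (S X) = X)
    (hT : ∀ u w : n → K, ∃ u' w', T (vecMulVec u w) = vecMulVec u' w')
    (hS : ∀ u w : n → K, ∃ u' w', S (vecMulVec u w) = vecMulVec u' w')
    {i₀ i₁ : n} (h01 : i₀ ≠ i₁) :
    (∀ i, ∃ u : n → K, u ≠ 0 ∧ ∀ w, ∃ w', T (vecMulVec (Pi.single i 1) w) = vecMulVec u w') ∨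
      (∀ i, ∃ v : n → K, v ≠ 0 ∧ ∀ w, ∃ z, T (vecMulVec (Pi.single i 1) w) = vecMulVec z v) := by
  rcases row_image_subset hT i₀ (Pi.single i₀ 1) with ⟨u₀, hu₀, h₀⟩ | ⟨v₀, hv₀, h₀⟩
  · refine Or.inl fun i => ?_
    by_cases hi : i = i₀
    · subst hi
      exact ⟨u₀, hu₀, h₀⟩
    rcases row_image_subset hT i₀ (Pi.single i 1) with ⟨u, hu, h⟩ | ⟨v, hv, h⟩
    · exact ⟨u, hu, h⟩
    · exact (not_mixed_rows hST hTS hS h01 (Ne.symm hi) hu₀ hv h₀ h).elim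
  · refine Or.inr fun i => ?_
    by_cases hi : i = i₀
    · subst hi
      exact ⟨v₀, hv₀, h₀⟩
    rcases row_image_subset hT i₀ (Pi.single i 1) with ⟨u, hu, h⟩ | ⟨v, hv, h⟩
    · exact (not_mixed_rows hST hTS hS h01 hi hu hv₀ h h₀).elim
    · exact ⟨v, hv, h⟩

/-- **Rows into row spaces forces columns into column spaces.**  If every row space `{e i wᵀ}` is
mapped into the row space of `u i`, then every column space `{z e jᵀ}` is mapped into a column
space (a row space containing all the `T(E i j)`, `i = i₀, i₁`, would make `u i₀ ∥ u i₁`).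
[cite: MarcusMoyls1959, §2, Lemma 4] -/
theorem cols_of_rows (hST : ∀ X, S (T X) = X)
    (hT : ∀ u w : n → K, ∃ u' w', T (vecMulVec u w) = vecMulVec u' w')
    (hS : ∀ u w : n → K, ∃ u' w', S (vecMulVec u w) = vecMulVec u' w')
    {i₀ i₁ : n} (h01 : i₀ ≠ i₁) {u : n → n → K} (hu : ∀ i, u i ≠ 0)
    (hL : ∀ i w, ∃ w', T (vecMulVec (Pi.single i 1) w) = vecMulVec (u i) w') (j : n) :
    ∃ v : n → K, v ≠ 0 ∧ ∀ z, ∃ z', T (vecMulVec z (Pi.single j 1)) = vecMulVec z' v := by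
  rcases col_image_subset hT i₀ (Pi.single j 1) with ⟨u', -, h'⟩ | h'
  · exfalso
    have key : ∀ i, ∃ c : K, u i = c • u' := by
      intro i
      obtain ⟨w', hw'⟩ := hL i (Pi.single j 1)
      obtain ⟨w'', hw''⟩ := h' (Pi.single i 1)
      have hne : w' ≠ 0 := by
        rintro rfl
        have h0 : vecMulVec (Pi.single i (1 : K)) (Pi.single j 1) = 0 := by
          rw [← hST (vecMulVec _ _), hw', vecMulVec_zero, map_zero]
        have := congr_fun (congr_fun h0 i) j
        simp [vecMulVec_apply] at this
      exact exists_eq_smul_of_vecMulVec_eq_right (hw'.symm.trans hw'') hne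
    obtain ⟨c₀, hc₀⟩ := key i₀
    obtain ⟨c₁, hc₁⟩ := key i₁
    obtain ⟨d, hd⟩ := exists_eq_smul_symm hc₀ (hu i₀)
    exact not_smul_of_rows hST hS h01 h01 (hL i₀) (hL i₁) (c₁ * d)
      (by rw [hc₁, hd, smul_smul])
  · exact h'

omit [Fintype n] in
/-- **The coefficients `c i j`.**  With rows into the row spaces of `u i` and columns into the
column spaces of `v j`, each `T(E i j)` is a non-zero multiple `c i j • u i (v j)ᵀ`.
[cite: MarcusMoyls1959, §2, Lemma 4 (5)] -/
theorem exists_coeff (hST : ∀ X, S (T X) = X) {u v : n → n → K} (hu : ∀ i, u i ≠ 0)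
    (hL : ∀ i w, ∃ w', T (vecMulVec (Pi.single i 1) w) = vecMulVec (u i) w')
    (hR : ∀ j z, ∃ z', T (vecMulVec z (Pi.single j 1)) = vecMulVec z' (v j)) :
    ∃ c : n → n → K, (∀ i j, c i j ≠ 0) ∧
      ∀ i j, T (vecMulVec (Pi.single i 1) (Pi.single j 1)) = c i j • vecMulVec (u i) (v j) := by
  have key : ∀ i j, ∃ c : K, c ≠ 0 ∧
      T (vecMulVec (Pi.single i 1) (Pi.single j 1)) = c • vecMulVec (u i) (v j) := by
    intro i j
    obtain ⟨w', hw'⟩ := hL i (Pi.single j 1)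
    obtain ⟨z', hz'⟩ := hR j (Pi.single i 1)
    obtain ⟨c, hc⟩ := exists_eq_smul_vecMulVec (hw'.symm.trans hz') (hu i)
    refine ⟨c, ?_, by rw [hw', hc]⟩
    rintro rfl
    have h0 : vecMulVec (Pi.single i (1 : K)) (Pi.single j 1) = 0 := by
      rw [← hST (vecMulVec _ _), hw', hc, zero_smul, map_zero]
    have := congr_fun (congr_fun h0 i) j
    simp [vecMulVec_apply] at this
  choose c hc0 hc using key
  exact ⟨c, hc0, hc⟩

omit [Fintype n] [DecidableEq n] in
/-- Elimination step for the rank-one property of the coefficients: if `α u + β w` (non-zero) and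
`γ u + δ w` are both multiples of one vector `u'`, where `w ∉ K u` and `u ≠ 0`, then
`α δ = γ β`. [folklore] -/
theorem minor_eq_zero_of_smul {u w u' : n → K} {α β γ δ t₁ t₂ : K} (hu : u ≠ 0)
    (hw : ∀ c : K, w ≠ c • u) (h1 : α • u + β • w = t₁ • u') (h2 : γ • u + δ • w = t₂ • u')
    (hne : α • u + β • w ≠ 0) : α * δ = γ * β := by
  have ht₁ : t₁ ≠ 0 := by
    rintro rfl
    exact hne (by rw [h1, zero_smul])
  -- `t₁ (γ u + δ w) = t₂ (α u + β w)`
  have hs : ∀ a, t₁ * (γ * u a + δ * w a) = t₂ * (α * u a + β * w a) := by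
    intro a
    have e1 := congr_fun h1 a
    have e2 := congr_fun h2 a
    simp only [Pi.add_apply, Pi.smul_apply, smul_eq_mul] at e1 e2
    rw [e2, e1]
    ring
  by_cases hD : t₁ * δ - t₂ * β = 0
  · obtain ⟨a, ha⟩ : ∃ a, u a ≠ 0 := by
      by_contra! h0
      exact hu (funext h0)
    have hγ : (t₁ * γ - t₂ * α) * u a = 0 := by linear_combination hs a - (w a) * hD
    rcases mul_eq_zero.mp hγ with hγ | hγ
    · refine mul_left_cancel₀ ht₁ ?_
      linear_combination α * hD - β * hγ
    · exact (ha hγ).elim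
  · exfalso
    refine hw ((t₂ * α - t₁ * γ) / (t₁ * δ - t₂ * β)) (funext fun a => ?_)
    rw [Pi.smul_apply, smul_eq_mul, div_mul_eq_mul_div, eq_div_iff hD]
    linear_combination hs a

/-- **The coefficient matrix has rank one**: `c i j * c k l = c i l * c k j` for `i ≠ k`
(consider the row space of `e i + e k`, whose image lies in a row space).
[cite: MarcusMoyls1959, §2, Lemma 4 (6)] -/
theorem coeff_minor (hST : ∀ X, S (T X) = X)
    (hT : ∀ u w : n → K, ∃ u' w', T (vecMulVec u w) = vecMulVec u' w')
    (hS : ∀ u w : n → K, ∃ u' w', S (vecMulVec u w) = vecMulVec u' w')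
    {i₀ i₁ : n} (h01 : i₀ ≠ i₁) {u v : n → n → K} (hu : ∀ i, u i ≠ 0) (hv : ∀ j, v j ≠ 0)
    (hL : ∀ i w, ∃ w', T (vecMulVec (Pi.single i 1) w) = vecMulVec (u i) w')
    (hR : ∀ j z, ∃ z', T (vecMulVec z (Pi.single j 1)) = vecMulVec z' (v j))
    {c : n → n → K} (hc0 : ∀ i j, c i j ≠ 0)
    (hc : ∀ i j, T (vecMulVec (Pi.single i 1) (Pi.single j 1)) = c i j • vecMulVec (u i) (v j))
    {i k : n} (hik : i ≠ k) (j l : n) : c i j * c k l = c i l * c k j := by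
  have huk : ∀ t : K, u k ≠ t • u i := not_smul_of_rows hST hS h01 hik (hL i) (hL k)
  have hrow : ∀ j, T (vecMulVec (Pi.single i 1 + Pi.single k 1) (Pi.single j 1)) =
      vecMulVec (c i j • u i + c k j • u k) (v j) := by
    intro j
    rw [add_vecMulVec, map_add, hc, hc, add_vecMulVec, smul_vecMulVec, smul_vecMulVec]
  have hx : ∀ j, c i j • u i + c k j • u k ≠ 0 := by
    intro j h0
    refine huk (-(c i j / c k j)) (funext fun a => ?_)
    have ha := congr_fun h0 a
    simp only [Pi.add_apply, Pi.smul_apply, smul_eq_mul, Pi.zero_apply] at ha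
    have hck := hc0 k j
    rw [Pi.smul_apply, smul_eq_mul]
    field_simp
    linear_combination ha
  rcases row_image_subset hT i₀ (Pi.single i 1 + Pi.single k 1) with ⟨u', -, h'⟩ | ⟨v', -, h'⟩
  · have hpar : ∀ j, ∃ t : K, c i j • u i + c k j • u k = t • u' := by
      intro j
      obtain ⟨w', hw'⟩ := h' (Pi.single j 1)
      rw [hrow] at hw'
      exact exists_eq_smul_of_vecMulVec_eq_right hw' (hv j)
    obtain ⟨t₁, ht₁⟩ := hpar j
    obtain ⟨t₂, ht₂⟩ := hpar l
    exact minor_eq_zero_of_smul (hu i) huk ht₁ ht₂ (hx j)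
  · exfalso
    have hpar : ∀ j, ∃ t : K, v j = t • v' := by
      intro j
      obtain ⟨z, hz⟩ := h' (Pi.single j 1)
      rw [hrow] at hz
      exact exists_eq_smul_of_vecMulVec_eq_left hz (hx j)
    obtain ⟨t₀, ht₀⟩ := hpar i₀
    obtain ⟨t₁, ht₁⟩ := hpar i₁
    obtain ⟨d, hd⟩ := exists_eq_smul_symm ht₀ (hv i₀)
    exact not_smul_of_cols hST hS h01 h01 (hR i₀) (hR i₁) (t₁ * d)
      (by rw [ht₁, hd, smul_smul])

/-- **Structure of rank-one preservers, row type.**  If every row space is mapped into a row space,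
then `T(X) = U X V` for the matrices `U = (c i i₀ • u i)` (columns) and
`V = ((c i₀ j / c i₀ i₀) • v j)` (rows). [cite: MarcusMoyls1959, §2, Theorem 1] -/
theorem exists_sandwich_of_rows (hST : ∀ X, S (T X) = X)
    (hT : ∀ u w : n → K, ∃ u' w', T (vecMulVec u w) = vecMulVec u' w')
    (hS : ∀ u w : n → K, ∃ u' w', S (vecMulVec u w) = vecMulVec u' w')
    {i₀ i₁ : n} (h01 : i₀ ≠ i₁)
    (hL : ∀ i, ∃ u : n → K, u ≠ 0 ∧ ∀ w, ∃ w', T (vecMulVec (Pi.single i 1) w) = vecMulVec u w') :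
    ∃ U V : Matrix n n K, ∀ X, T X = U * X * V := by
  choose u hu hLu using hL
  have hRv := fun j => cols_of_rows hST hT hS h01 hu hLu j
  choose v hv hRv using hRv
  obtain ⟨c, hc0, hc⟩ := exists_coeff hST hu hLu hRv
  have hcij : ∀ i j, c i j = c i i₀ * (c i₀ j / c i₀ i₀) := by
    intro i j
    have h00 := hc0 i₀ i₀
    by_cases hi : i = i₀
    · subst hi
      field_simp
    · have hm := coeff_minor hST hT hS h01 hu hv hLu hRv hc0 hc hi j i₀
      field_simp
      linear_combination hm
  refine ⟨Matrix.of fun a i => c i i₀ * u i a, Matrix.of fun j b => c i₀ j / c i₀ i₀ * v j b, ?_⟩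
  have hbasis : ∀ i j, T (vecMulVec (Pi.single i 1) (Pi.single j 1)) =
      (Matrix.of fun a i => c i i₀ * u i a) * vecMulVec (Pi.single i 1) (Pi.single j 1) *
        Matrix.of fun j b => c i₀ j / c i₀ i₀ * v j b := by
    intro i j
    rw [hc, mul_vecMulVec, vecMulVec_mul, hcij i j]
    ext a b
    simp only [Matrix.smul_apply, vecMulVec_apply, smul_eq_mul, mulVec, vecMul, dotProduct,
      of_apply, Pi.single_apply, mul_ite, ite_mul, mul_one, one_mul, mul_zero, zero_mul,
      Finset.sum_ite_eq', Finset.mem_univ, if_true]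
    ring
  intro X
  induction X using Matrix.induction_on' with
  | h_zero => simp
  | h_add X Y hX hY => rw [map_add, hX, hY, Matrix.mul_add, Matrix.add_mul]
  | h_std_basis i j x =>
    rw [show single i j x = x • vecMulVec (Pi.single i 1) (Pi.single j (1 : K)) by
      rw [← single_eq_single_vecMulVec_single, smul_single, smul_eq_mul, mul_one],
      map_smul, hbasis, Matrix.mul_smul, Matrix.smul_mul]

/-- **Marcus–Moyls' Theorem 1 (Hua 1948, Jacob 1955) for bijective rank-one preservers.**  Let
`T` be a linear map of `M_n(K)` (`n ≥ 2`, witnessed by `i₀ ≠ i₁`) with two-sided inverse `S`,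
such that `T` and `S` map matrices of rank `≤ 1` to matrices of rank `≤ 1`.  Then there are
matrices `U, V` with `T(X) = U X V` for all `X`, or `T(X) = U Xᵀ V` for all `X`.  (Marcus–Moyls
assume instead that `T` preserves every rank and need not be invertible; for determinant
preservers both sets of hypotheses are available, Lemmas 7–8.) [cite: MarcusMoyls1959, §2, Theorem 1] -/
theorem exists_sandwich_or_transpose_sandwich (hST : ∀ X, S (T X) = X) (hTS : ∀ X, T (S X) = X)
    (hT : ∀ u w : n → K, ∃ u' w', T (vecMulVec u w) = vecMulVec u' w')
    (hS : ∀ u w : n → K, ∃ u' w', S (vecMulVec u w) = vecMulVec u' w')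
    {i₀ i₁ : n} (h01 : i₀ ≠ i₁) :
    ∃ U V : Matrix n n K, (∀ X, T X = U * X * V) ∨ (∀ X, T X = U * Xᵀ * V) := by
  rcases rows_uniform hST hTS hT hS h01 with hL | hR
  · obtain ⟨U, V, h⟩ := exists_sandwich_of_rows hST hT hS h01 hL
    exact ⟨U, V, Or.inl h⟩
  · set τ := (transposeLinearEquiv n n K K).toLinearMap with hτ
    have hST' : ∀ X, (S ∘ₗ τ) ((τ ∘ₗ T) X) = X := fun X => by simp [hτ, hST]
    have hT' : ∀ u w : n → K, ∃ u' w', (τ ∘ₗ T) (vecMulVec u w) = vecMulVec u' w' := by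
      intro u w
      obtain ⟨u', w', huw⟩ := hT u w
      exact ⟨w', u', by simp [hτ, huw]⟩
    have hS' : ∀ u w : n → K, ∃ u' w', (S ∘ₗ τ) (vecMulVec u w) = vecMulVec u' w' := by
      intro u w
      obtain ⟨u', w', huw⟩ := hS w u
      exact ⟨u', w', by simp [hτ, huw]⟩
    have hL' : ∀ i, ∃ u : n → K, u ≠ 0 ∧
        ∀ w, ∃ w', (τ ∘ₗ T) (vecMulVec (Pi.single i 1) w) = vecMulVec u w' := by
      intro i
      obtain ⟨v, hv, h⟩ := hR i
      refine ⟨v, hv, fun w => ?_⟩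
      obtain ⟨z, hz⟩ := h w
      exact ⟨z, by simp [hτ, hz]⟩
    obtain ⟨U, V, h⟩ := exists_sandwich_of_rows hST' hT' hS' h01 hL'
    refine ⟨Vᵀ, Uᵀ, Or.inr fun X => ?_⟩
    have hX : (T X)ᵀ = U * X * V := by simpa [hτ] using h X
    rw [← transpose_transpose (T X), hX, transpose_mul, transpose_mul, Matrix.mul_assoc]

end Preserver

/-! ### Determinants of rank-one perturbations (towards Lemma 8) -/

section Det

omit [Fintype n] in
/-- Adding `c e_a wᵀ` changes only row `a`. [folklore] -/
theorem add_vecMulVec_single (Z : Matrix n n K) (a : n) (c : K) (w : n → K) :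
    Z + vecMulVec (Pi.single a c) w = Z.updateRow a (Z a + c • w) := by
  ext i j
  by_cases h : i = a
  · subst h
    simp [vecMulVec_apply, updateRow_apply]
  · simp [vecMulVec_apply, updateRow_apply, h]

/-- Row-linearity of the determinant: `det (Z + c e_a wᵀ) = det Z + c det (Z with row a := w)`.
[folklore] -/
theorem det_add_vecMulVec_single (Z : Matrix n n K) (a : n) (c : K) (w : n → K) :
    (Z + vecMulVec (Pi.single a c) w).det = Z.det + c * (Z.updateRow a w).det := by
  rw [add_vecMulVec_single, det_updateRow_add, updateRow_eq_self, det_updateRow_smul]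

omit [Fintype n] in
/-- Replacing row `i` commutes with adding a matrix whose row `i` vanishes. [folklore] -/
theorem updateRow_add_of_row_eq_zero (Y V : Matrix n n K) (i : n) (w : n → K) (hV : V i = 0) :
    (Y + V).updateRow i w = Y.updateRow i w + V := by
  ext r j
  by_cases h : r = i
  · subst h
    simp [updateRow_apply, hV]
  · simp [updateRow_apply, h]

/-- **Determinant of a rank-one perturbation** (multilinearity in the rows; the adjugate form of
the matrix determinant lemma): `det (Y + u wᵀ) = det Y + ∑ᵢ uᵢ det (Y with row i := w)`.
[folklore] -/
theorem det_add_vecMulVec (Y : Matrix n n K) (u w : n → K) :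
    (Y + vecMulVec u w).det = Y.det + ∑ i, u i * (Y.updateRow i w).det := by
  suffices h : ∀ (s : Finset n) (Y : Matrix n n K) (u : n → K), (∀ i ∉ s, u i = 0) →
      (Y + vecMulVec u w).det = Y.det + ∑ i ∈ s, u i * (Y.updateRow i w).det from
    h Finset.univ Y u (fun i hi => (hi (Finset.mem_univ i)).elim)
  intro s
  induction s using Finset.induction_on with
  | empty =>
    intro Y u hu
    have hu0 : u = 0 := funext fun i => hu i (Finset.notMem_empty i)
    simp [hu0]
  | insert a s ha IH =>
    intro Y u hu
    -- split off the `a`-th row: `u = u' + uₐ eₐ` with `u'` supported in `s`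
    set u' : n → K := Function.update u a 0 with hu'
    have hsupp : ∀ i ∉ s, u' i = 0 := by
      intro i hi
      by_cases hia : i = a
      · subst hia
        simp [hu']
      · rw [hu', Function.update_of_ne hia]
        exact hu i (by simp [hia, hi])
    have hsplit : vecMulVec u w = vecMulVec (Pi.single a (u a)) w + vecMulVec u' w := by
      rw [← add_vecMulVec]
      congr 1
      funext i
      by_cases hia : i = a
      · subst hia
        simp [hu']
      · simp [hu', hia]
    have hrow : (vecMulVec (Pi.single a (u a)) w) a = u a • w := by
      funext j
      simp [vecMulVec_apply]
    rw [hsplit, ← add_assoc, IH _ u' hsupp, det_add_vecMulVec_single, Finset.sum_insert ha]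
    have hterm : ∀ i ∈ s, u' i * ((Y + vecMulVec (Pi.single a (u a)) w).updateRow i w).det =
        u i * (Y.updateRow i w).det := by
      intro i hi
      have hia : i ≠ a := fun h => ha (h ▸ hi)
      have hVi : (vecMulVec (Pi.single a (u a)) w) i = 0 := by
        funext j
        simp [vecMulVec_apply, hia]
      rw [updateRow_add_of_row_eq_zero _ _ _ _ hVi, det_add_vecMulVec_single,
        det_zero_of_row_eq hia (M := (Y.updateRow i w).updateRow a w) (by simp [hia]), mul_zero,
        add_zero, hu', Function.update_of_ne hia]
    rw [Finset.sum_congr rfl hterm]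
    ring

/-- **Second differences of `det` vanish in rank-one directions**:
`det (Y + u wᵀ) + det (Y - u wᵀ) = 2 det Y` (the polynomial `t ↦ det (Y + t u wᵀ)` is affine; this
is the usable half of Marcus–Moyls' Lemma 8, "`det (x Y₁ + Y₃)` has degree `≤ ρ(Y₁)` in `x`").
[cite: MarcusMoyls1959, §3, Lemma 8] -/
theorem det_add_add_det_sub_of_rankOne (Y : Matrix n n K) (u w : n → K) :
    (Y + vecMulVec u w).det + (Y - vecMulVec u w).det = 2 * Y.det := by
  rw [sub_eq_add_neg, ← neg_vecMulVec, det_add_vecMulVec, det_add_vecMulVec]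
  simp only [Pi.neg_apply, neg_mul, Finset.sum_neg_distrib]
  ring

/-- **Witness for rank `≥ 2`** (the other half of Lemma 8): if `X` is not of the form `u wᵀ` then
for some `Y` the second difference `det (Y + X) + det (Y - X) - 2 det Y` is non-zero (bring `X` to
diagonal form `P D Q` by elementary operations, Mathlib's `Matrix.Pivot`; two diagonal entries
`d a, d c` are non-zero; take `Y = P diag(y) Q` with `y a = -d a`, `y i = [d i = 0]` otherwise).
Requires `2 ≠ 0` in `K`. [cite: MarcusMoyls1959, §3, Lemma 8] -/
theorem exists_det_add_add_det_sub_ne (h2 : (2 : K) ≠ 0) {X : Matrix n n K}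
    (hX : ∀ u w : n → K, X ≠ vecMulVec u w) :
    ∃ Y : Matrix n n K, (Y + X).det + (Y - X).det ≠ 2 * Y.det := by
  obtain ⟨L, L', d, hd⟩ := Pivot.exists_list_transvec_mul_diagonal_mul_list_transvec X
  set P := (L.map TransvectionStruct.toMatrix).prod with hP
  set Q := (L'.map TransvectionStruct.toMatrix).prod with hQ
  have hPdet : P.det = 1 := TransvectionStruct.det_toMatrix_prod L
  have hQdet : Q.det = 1 := TransvectionStruct.det_toMatrix_prod L'
  have hdet : ∀ v : n → K, (P * diagonal v * Q).det = ∏ i, v i := by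
    intro v
    rw [det_mul, det_mul, hPdet, hQdet, det_diagonal, one_mul, mul_one]
  -- two non-zero diagonal entries
  obtain ⟨a, c, hac, ha, hc⟩ : ∃ a c, a ≠ c ∧ d a ≠ 0 ∧ d c ≠ 0 := by
    by_contra! H
    have hdiag0 : diagonal (0 : n → K) = 0 := by
      ext i j
      simp [diagonal_apply]
    by_cases hd0 : d = 0
    · refine hX 0 0 ?_
      rw [hd, hd0, hdiag0, Matrix.mul_zero, Matrix.zero_mul, vecMulVec_zero]
    obtain ⟨a, ha⟩ : ∃ a, d a ≠ 0 := by
      by_contra! h0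
      exact hd0 (funext h0)
    have hda : d = Pi.single a (d a) := by
      funext c
      by_cases hca : c = a
      · subst hca
        simp
      · rw [Pi.single_eq_of_ne hca]
        exact H a c (Ne.symm hca) ha
    have hdiag : diagonal d = vecMulVec (d a • Pi.single a 1) (Pi.single a (1 : K)) := by
      conv_lhs => rw [hda]
      rw [diagonal_single, smul_vecMulVec, ← single_eq_single_vecMulVec_single, smul_single,
        smul_eq_mul, mul_one]
    refine hX (P *ᵥ (d a • Pi.single a 1)) (Pi.single a 1 ᵥ* Q) ?_
    rw [hd, hdiag, Matrix.mul_assoc, vecMulVec_mul, mul_vecMulVec]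
  -- the witness `y`: `y a = -d a`, `y c = 0`, and `y i - d i ≠ 0` for every `i`
  obtain ⟨y, hya, hyc, hy⟩ : ∃ y : n → K, y a + d a = 0 ∧ y c = 0 ∧ ∀ i, y i - d i ≠ 0 := by
    classical
    refine ⟨fun i => if i = a then -d a else if d i = 0 then 1 else 0, by simp,
      by simp [Ne.symm hac, hc], fun i => ?_⟩
    dsimp only
    by_cases hia : i = a
    · subst hia
      rw [if_pos rfl, show -d i - d i = -(2 * d i) by ring]
      exact neg_ne_zero.mpr (mul_ne_zero h2 ha)
    · rw [if_neg hia]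
      by_cases hdi : d i = 0
      · rw [if_pos hdi, hdi, sub_zero]
        exact one_ne_zero
      · rw [if_neg hdi, zero_sub]
        exact neg_ne_zero.mpr hdi
  refine ⟨P * diagonal y * Q, ?_⟩
  have hadd : P * diagonal y * Q + X = P * diagonal (fun i => y i + d i) * Q := by
    rw [hd, ← Matrix.add_mul, ← Matrix.mul_add, diagonal_add]
  have hsub : P * diagonal y * Q - X = P * diagonal (fun i => y i - d i) * Q := by
    rw [hd, ← Matrix.sub_mul, ← Matrix.mul_sub, diagonal_sub]
  rw [hadd, hsub, hdet, hdet, hdet]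
  have h1 : ∏ i, (y i + d i) = 0 := Finset.prod_eq_zero (Finset.mem_univ a) hya
  have h3 : ∏ i, y i = 0 := Finset.prod_eq_zero (Finset.mem_univ c) hyc
  have h2' : ∏ i, (y i - d i) ≠ 0 := Finset.prod_ne_zero_iff.mpr fun i _ => hy i
  rw [h1, h3, zero_add, mul_zero]
  exact h2'

end Det

/-! ### Determinant preservers (Lemmas 7 and 8) -/

section DetPreserver

variable {T S : Matrix n n K →ₗ[K] Matrix n n K}

/-- **Marcus–Moyls' Lemma 7**: a linear map `T` of `M_n(K)` with `det (T X) = det X` for all `X`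
is injective ("non-singular and hence onto").  Proof as printed: if `T A = 0` then
`det (A + X) = det X` for all `X`; with `A = P D Q` (`D` diagonal, `P, Q` products of
transvections) take `X = P D' Q`, `D' = [D = 0]`. [cite: MarcusMoyls1959, §3, Lemma 7] -/
theorem injective_of_det_eq (hdet : ∀ X, (T X).det = X.det) : Function.Injective T := by
  refine (injective_iff_map_eq_zero T).mpr fun A hA => ?_
  by_contra hA0
  have hAX : ∀ X, (A + X).det = X.det := fun X => by rw [← hdet (A + X), map_add, hA, zero_add, hdet]
  obtain ⟨L, L', d, hd⟩ := Pivot.exists_list_transvec_mul_diagonal_mul_list_transvec A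
  set P := (L.map TransvectionStruct.toMatrix).prod with hP
  set Q := (L'.map TransvectionStruct.toMatrix).prod with hQ
  have hdet' : ∀ v : n → K, (P * diagonal v * Q).det = ∏ i, v i := by
    intro v
    rw [det_mul, det_mul, TransvectionStruct.det_toMatrix_prod L,
      TransvectionStruct.det_toMatrix_prod L', det_diagonal, one_mul, mul_one]
  obtain ⟨i, hi⟩ : ∃ i, d i ≠ 0 := by
    by_contra! h0
    refine hA0 ?_
    have hdiag0 : diagonal d = 0 := by
      ext i j
      simp [diagonal_apply, h0]
    rw [hd, hdiag0, Matrix.mul_zero, Matrix.zero_mul]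
  -- `d' = [d = 0]`
  obtain ⟨d', hd', hd'i⟩ : ∃ d' : n → K, (∀ j, d j + d' j ≠ 0) ∧ d' i = 0 := by
    classical
    refine ⟨fun j => if d j = 0 then 1 else 0, fun j => ?_, by simp [hi]⟩
    dsimp only
    by_cases hdj : d j = 0
    · rw [if_pos hdj, hdj, zero_add]
      exact one_ne_zero
    · rwa [if_neg hdj, add_zero]
  have h := hAX (P * diagonal d' * Q)
  rw [hd, ← Matrix.add_mul, ← Matrix.mul_add, diagonal_add, hdet', hdet'] at h
  have hl : ∏ j, (d j + d' j) ≠ 0 := Finset.prod_ne_zero_iff.mpr fun j _ => hd' j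
  have hr : ∏ j, d' j = 0 := Finset.prod_eq_zero (Finset.mem_univ i) hd'i
  exact hl (h.trans hr)

/-- **Marcus–Moyls' Lemma 8 (rank one)**: a bijective determinant preserver maps matrices of rank
`≤ 1` to matrices of rank `≤ 1` (the rank-one criterion
`∀ Y, det (Y + X) + det (Y - X) = 2 det Y` is transported by `T`).  Requires `2 ≠ 0` in `K`.
[cite: MarcusMoyls1959, §3, Lemma 8] -/
theorem rankOne_map_of_det_eq (h2 : (2 : K) ≠ 0) (hTS : ∀ X, T (S X) = X)
    (hdet : ∀ X, (T X).det = X.det) (u w : n → K) :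
    ∃ u' w', T (vecMulVec u w) = vecMulVec u' w' := by
  by_contra! H
  obtain ⟨Y, hY⟩ := exists_det_add_add_det_sub_ne h2 (fun u' w' => H u' w')
  refine hY ?_
  have hSY : (S Y).det = Y.det := by rw [← hdet (S Y), hTS]
  rw [← hTS Y, ← map_add, ← map_sub, hdet, hdet, hdet, det_add_add_det_sub_of_rankOne, hSY]

/-- **Theorem 1 + Lemmas 7–8 combined**: a linear determinant preserver `T` of `M_n(K)`
(`n ≥ 2`, `char K ≠ 2`) is a sandwich `X ↦ U X V` or `X ↦ U Xᵀ V` with `det U · det V = 1`.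
[cite: MarcusMoyls1959, §3, Theorem 2] -/
theorem exists_sandwich_of_det_eq (h2 : (2 : K) ≠ 0) (hdet : ∀ X, (T X).det = X.det)
    {i₀ i₁ : n} (h01 : i₀ ≠ i₁) :
    ∃ U V : Matrix n n K, U.det * V.det = 1 ∧
      ((∀ X, T X = U * X * V) ∨ (∀ X, T X = U * Xᵀ * V)) := by
  have hinj := injective_of_det_eq hdet
  have hbij : Function.Bijective T := ⟨hinj, LinearMap.injective_iff_surjective.mp hinj⟩
  set E := LinearEquiv.ofBijective T hbij with hE
  have hST : ∀ X, E.symm.toLinearMap (T X) = X := fun X => E.symm_apply_apply X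
  have hTS : ∀ X, T (E.symm.toLinearMap X) = X := fun X => E.apply_symm_apply X
  have hdetS : ∀ X, (E.symm.toLinearMap X).det = X.det := fun X => by
    rw [← hdet (E.symm.toLinearMap X), hTS]
  have hT := rankOne_map_of_det_eq h2 hTS hdet
  have hS := rankOne_map_of_det_eq h2 hST hdetS
  obtain ⟨U, V, hUV⟩ := exists_sandwich_or_transpose_sandwich hST hTS hT hS h01
  refine ⟨U, V, ?_, hUV⟩
  have h1 := hdet 1
  rcases hUV with h | h
  · rw [h, Matrix.mul_one, det_mul, det_one] at h1
    exact h1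
  · rw [h, transpose_one, Matrix.mul_one, det_mul, det_one] at h1
    exact h1

end DetPreserver

end MarcusMoyls

/-! ### The discharge over `ℂ` -/

section Discharge

open MvPolynomial Matrix
open Literature.Computability.AlgebraicComplexity (linSubst linSubst_X linSubst_C eval_detPoly)

/-- Evaluating a linear substitution: `(M · f)(x) = f(Mᵀ x)` (the convention of `linSubst`,
`X i ↦ ∑ j, M j i • X j`). [folklore] -/
theorem MarcusMoyls.eval_linSubst {σ : Type*} [Fintype σ] (M : Matrix σ σ ℂ) (x : σ → ℂ)
    (f : MvPolynomial σ ℂ) : eval x (linSubst σ ℂ M f) = eval (Mᵀ *ᵥ x) f := by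
  induction f using MvPolynomial.induction_on with
  | C a => rw [linSubst_C, eval_C, eval_C]
  | add p q hp hq => rw [map_add, map_add, map_add, hp, hq]
  | mul_X p i hp =>
    rw [map_mul, map_mul, map_mul, hp, linSubst_X, eval_X]
    congr 1
    simp [Matrix.mulVec, dotProduct, smul_eval]

/-- Evaluating the determinant form `det_m` (lexicographic matrix variables) at `y` gives the
determinant of the matrix `(y (a, b))`. [folklore] -/
theorem MarcusMoyls.eval_detFormLex (m : ℕ) (y : MatIdx m → ℂ) :
    eval y (detFormLex ℂ m) = (Matrix.of fun a b => y (toLex (a, b))).det := by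
  rw [detFormLex, eval_rename, eval_detPoly]
  rfl

/-- A matrix `M ∈ End(ℂ^{m²})` stabilising `det_m` gives a determinant preserver
`x ↦ mat (Mᵀ x)` (evaluate the polynomial identity). [folklore] -/
theorem MarcusMoyls.det_eq_of_linSubst_detFormLex (m : ℕ) (M : Matrix (MatIdx m) (MatIdx m) ℂ)
    (hM : linSubst (MatIdx m) ℂ M (detFormLex ℂ m) = detFormLex ℂ m) (x : MatIdx m → ℂ) :
    (Matrix.of fun a b => (Mᵀ *ᵥ x) (toLex (a, b))).det =
      (Matrix.of fun a b => x (toLex (a, b))).det := by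
  have h := congr_arg (eval x) hM
  rwa [MarcusMoyls.eval_linSubst, MarcusMoyls.eval_detFormLex, MarcusMoyls.eval_detFormLex] at h

/-- **Marcus–Moyls' Theorem 2, (ii) ⇒ (iii), for an abstract linear determinant preserver of
`M_m(ℂ)`**: `T(X) = P X Q` or `T(X) = P Xᵀ Q` with `det P = det Q = 1` (for `m ≥ 2` by Theorem 1
and Lemmas 7–8, then "choose `U = U₁/(det U₁)^{1/n}` and `V = V₁/(det V₁)^{1/n}`"; `m ≤ 1` is
trivial). [cite: MarcusMoyls1959, §3, Theorem 2] -/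
theorem MarcusMoyls.exists_unimodular_sandwich_of_det_eq {m : ℕ}
    (T : Matrix (Fin m) (Fin m) ℂ →ₗ[ℂ] Matrix (Fin m) (Fin m) ℂ) (hdet : ∀ X, (T X).det = X.det) :
    ∃ P Q : Matrix (Fin m) (Fin m) ℂ, P.det = 1 ∧ Q.det = 1 ∧
      ((∀ X, T X = P * X * Q) ∨ (∀ X, T X = P * Xᵀ * Q)) := by
  rcases m with _ | _ | m
  · exact ⟨1, 1, det_one, det_one, Or.inl fun X => Subsingleton.elim _ _⟩
  · refine ⟨T 1, 1, by rw [hdet, det_one], det_one, Or.inl fun X => ?_⟩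
    have hX : X = X 0 0 • (1 : Matrix (Fin 1) (Fin 1) ℂ) := by
      ext i j
      fin_cases i
      fin_cases j
      simp
    rw [hX, map_smul, Matrix.mul_smul, Matrix.mul_one, Matrix.mul_one]
  · obtain ⟨U, V, hUV, h⟩ :=
      MarcusMoyls.exists_sandwich_of_det_eq two_ne_zero hdet (Fin.zero_ne_one (n := m))
    obtain ⟨c, hc⟩ := IsAlgClosed.exists_pow_nat_eq U.det (Nat.succ_pos (m + 1))
    have hc0 : c ≠ 0 := by
      rintro rfl
      rw [zero_pow (Nat.succ_ne_zero _)] at hc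
      rw [← hc, zero_mul] at hUV
      exact zero_ne_one hUV
    refine ⟨c⁻¹ • U, c • V, ?_, ?_, ?_⟩
    · rw [det_smul, Fintype.card_fin, ← hc, inv_pow, inv_mul_cancel₀ (pow_ne_zero _ hc0)]
    · rw [det_smul, Fintype.card_fin, hc, hUV]
    · have hsmul : ∀ Y : Matrix (Fin (m + 2)) (Fin (m + 2)) ℂ,
          c⁻¹ • U * Y * (c • V) = U * Y * V := by
        intro Y
        rw [Matrix.smul_mul, Matrix.smul_mul, Matrix.mul_smul, smul_smul, inv_mul_cancel₀ hc0,
          one_smul]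
      rcases h with h | h
      · exact Or.inl fun X => by rw [h, hsmul]
      · exact Or.inr fun X => by rw [h, hsmul]

/-- **Discharge of `frobenius_detPreserver_unimodular_sandwich`** (Marcus–Moyls 1959, Thm. 2,
(ii) ⇒ (iii); Frobenius 1897): a square matrix `M` over `MatIdx m` whose linear substitution fixes
`det_m` acts on `M_m(ℂ)`, `X ↦ mat (Mᵀ · vec X)`, as `X ↦ P X Q` or `X ↦ P Xᵀ Q` with
`det P = det Q = 1`.  Proof: the map `T : X ↦ mat (Mᵀ · vec X)` is linear and preserves the
determinant (evaluate the identity `M · det_m = det_m`), so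
`MarcusMoyls.exists_unimodular_sandwich_of_det_eq` applies.
[cite: MarcusMoyls1959, Thm. 2 (p. 65) with Lemmas 7, 8 and Thm. 1] -/
theorem frobenius_detPreserver_unimodular_sandwich_holds :
    frobenius_detPreserver_unimodular_sandwich := by
  intro m M hM
  let T : Matrix (Fin m) (Fin m) ℂ →ₗ[ℂ] Matrix (Fin m) (Fin m) ℂ :=
    { toFun := fun X =>
        Matrix.of fun a b => (Mᵀ *ᵥ fun p => X (ofLex p).1 (ofLex p).2) (toLex (a, b))
      map_add' := by
        intro X Y
        ext a b
        simp only [Matrix.add_apply, Matrix.of_apply]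
        rw [← Pi.add_apply (Mᵀ *ᵥ _) (Mᵀ *ᵥ _), ← Matrix.mulVec_add]
        rfl
      map_smul' := by
        intro c X
        ext a b
        simp only [Matrix.smul_apply, Matrix.of_apply, RingHom.id_apply, Matrix.mulVec,
          dotProduct, smul_eq_mul, Finset.mul_sum]
        exact Finset.sum_congr rfl fun p _ => by ring }
  have hTx : ∀ x : MatIdx m → ℂ, T (Matrix.of fun a b => x (toLex (a, b))) =
      Matrix.of fun a b => (Mᵀ *ᵥ x) (toLex (a, b)) := by
    intro x
    have hx : (fun p : MatIdx m => (Matrix.of fun a b => x (toLex (a, b))) (ofLex p).1 (ofLex p).2)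
        = x := by
      funext p
      simp
    simp only [T, LinearMap.coe_mk, AddHom.coe_mk]
    rw [hx]
  have hdet : ∀ X, (T X).det = X.det := by
    intro X
    have h := MarcusMoyls.det_eq_of_linSubst_detFormLex m M hM (fun p => X (ofLex p).1 (ofLex p).2)
    have hX : (Matrix.of fun a b => (fun p : MatIdx m => X (ofLex p).1 (ofLex p).2) (toLex (a, b)))
        = X := by
      ext a b
      simp
    rw [hX] at h
    exact h
  obtain ⟨P, Q, hP, hQ, h⟩ := MarcusMoyls.exists_unimodular_sandwich_of_det_eq T hdet
  refine ⟨P, Q, hP, hQ, ?_⟩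
  rcases h with h | h
  · exact Or.inl fun x => by rw [← hTx, h]
  · exact Or.inr fun x => by rw [← hTx, h]

end Discharge

end Literature.NumberTheory.DiophantineGeometry
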